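import Summits.HodgeConjecture.HodgeConjecture.Theses.HeckePrymWeil
import Literature.AlgebraicGeometry.Motives.AbelianVarietyProduct

/-!
# Sketch — crux-ideate `stmt-HodgeConjecture-14374` (`SummitOffWeilSector`), ideator 3 (gen 1, round 1)

First-lemma signatures for the crux idea card `weil-induction-anchors` ("induce the sector along
`K ⊂ E`": at every point `B ⊗_K E ≅ Bᵉ` of an `E`-Weil family, `E ⊇ K = ℚ(√-p)` a CM field, the
`E`-Weil classes are `ℚ`-combinations of pull-backs of the `K`-Weil classes of `B` along the
homomorphisms `m_k : Bᵉ → B`, `(x_j) ↦ Σ k_j x_j`; hence SECTOR-algebraic).  Everything is a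
`def … : Prop` or a proved triviality; nothing about the crux is asserted.
-/

noncomputable section

set_option linter.dupNamespace false
set_option linter.unusedVariables false

open CategoryTheory Complex

namespace Summit.HodgeConjecture.HodgeConjecture.Cruxes.SummitOffWeilSector.WeilInductionAnchors

open Literature.AlgebraicGeometry.Motives Literature.AlgebraicGeometry.HodgeTheory
open Summit.HodgeConjecture.HodgeConjecture.Theses.HeckePrymWeil

/-! ## §0 The antecedent of the crux (verbatim body) -/

/-- Complexified Weil span of `(B, ψ)`, `ψ ∘ ψ = -p`, in degree `2k` (the route's typing). -/
def weilEigenSpan (B : AbelianVariety ℂ) (ψ : B ⟶ B) (p k : ℕ) :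
    Submodule ℂ (complexBetti B.X (2 * k)) :=
  Module.End.eigenspace (complexBetti.map (𝟙 B + ψ).hom.hom.hom (2 * k)).hom
      ((1 + I * (Real.sqrt (p : ℝ) : ℂ)) ^ (2 * k)) ⊔
    Module.End.eigenspace (complexBetti.map (𝟙 B + ψ).hom.hom.hom (2 * k)).hom
      ((1 - I * (Real.sqrt (p : ℝ) : ℂ)) ^ (2 * k))

/-- One rung of the ℚ(√-p) Hodge–Weil sector in dimension `2n`. -/
def WeilRung (p n : ℕ) : Prop :=
  ∀ (A : AbelianVariety ℂ) (φ : A ⟶ A), A.dim = 2 * n → φ ≫ φ = -((p : ℤ) • 𝟙 A) →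
    ∀ c : complexBetti A.X (2 * n), IsRationalClass c → IsOfHodgeType (2 * n) A.X (2 * n) n n c →
      c ∈ weilEigenSpan A φ p n → c ∈ algebraicClasses A.X n

/-- The antecedent of the crux: the whole sector, `p ≡ 3 (4)` prime, `p ≥ 7`, `n ≥ 1`. -/
def WeilSector : Prop :=
  ∀ p : ℕ, p.Prime → p % 4 = 3 → 7 ≤ p → ∀ n : ℕ, 1 ≤ n → WeilRung p n

/-- Readback: the crux IS `WeilSector → HodgeConjecture`, definitionally. -/
theorem summitOffWeilSector_iff : SummitOffWeilSector ↔ (WeilSector → _root_.HodgeConjecture) :=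
  Iff.rfl

/-! ## §1 The induction maps `m_k : B × B → B` and the stretching maps `T_k = 𝟙 × [k]` -/

/-- `m : B × B → B`, `(x, y) ↦ x + y` (the case `k = (1,1)` of `m_k`). -/
def addMap (B : AbelianVariety ℂ) : B.prod B ⟶ B :=
  AbelianVariety.fst B B + AbelianVariety.snd B B

/-- `T_k = 𝟙 × [k] : B × B → B × B`, `(x, y) ↦ (x, k y)`; pulling back along `T_k` multiplies the
Künneth piece of bidegree `(2n - a, a)` of a degree-`2n` class by `kᵃ`, so the joint
eigen-decomposition under `T_k^*` (`k ≥ 2`) IS the Künneth decomposition, typed without Künneth. -/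
def stretchMap (B : AbelianVariety ℂ) (k : ℕ) : B.prod B ⟶ B.prod B :=
  AbelianVariety.prodLift (AbelianVariety.fst B B) (k • AbelianVariety.snd B B)

theorem stretchMap_fst (B : AbelianVariety ℂ) (k : ℕ) :
    stretchMap B k ≫ AbelianVariety.fst B B = AbelianVariety.fst B B :=
  AbelianVariety.prodLift_fst _ _

theorem stretchMap_snd (B : AbelianVariety ℂ) (k : ℕ) :
    stretchMap B k ≫ AbelianVariety.snd B B = k • AbelianVariety.snd B B :=
  AbelianVariety.prodLift_snd _ _

/-- The `kᵃ`-eigenspace of `T_k^*` on `H^{2n}(B × B; ℂ)` = the Künneth piece `H^{2n-a}(B) ⊗ H^{a}(B)`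
(for `k ≥ 2` the eigenvalues `k⁰, …, k^{2n}` are pairwise distinct). -/
def kunnethPiece (B : AbelianVariety ℂ) (k n a : ℕ) : Submodule ℂ (complexBetti (B.prod B).X (2 * n)) :=
  Module.End.eigenspace (complexBetti.map (stretchMap B k).hom.hom.hom (2 * n)).hom ((k : ℂ) ^ a)

/-! ## §2 FIRST LEMMA of the line: induced anchors (degree `e = 2`, i.e. quartic CM fields `E = K·ℚ(√q)`)

Under the antecedent, for every admissible `(B, φ)` and every rational Hodge class `c` of the Weil
span, the pull-back `m^* c ∈ H^{2n}(B × B)` is a SUM OF ALGEBRAIC KÜNNETH PIECES.  The pieces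
`D_a(c)` (`a = 0, …, 2n`) span, together with their `φ`-twists, all `E`-Weil classes of
`B ⊗_K E ≅ B × B` for every quartic CM field `E = K·ℚ(√q)` (Vandermonde in `k`: `m_k^* c = Σ_a kᵃ D_a(c)`
with `m_k = fst + k • snd`), and pulling back algebraic classes along homomorphisms keeps them
algebraic — so this is "the sector makes the `K`-induced locus of every `E`-Weil family an anchor".
Provable now modulo: pull-back functoriality of `algebraicClasses` along `m_k` (refined Gysin),
`ℂ`-linearity, and the eigen-decomposition of `m^* c` under the algebraic operators `T_k^*`. -/
def InducedAnchorsTwo : Prop :=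
  WeilSector → ∀ p : ℕ, p.Prime → p % 4 = 3 → 7 ≤ p → ∀ n : ℕ, 1 ≤ n →
    ∀ (B : AbelianVariety ℂ) (φ : B ⟶ B), B.dim = 2 * n → φ ≫ φ = -((p : ℤ) • 𝟙 B) →
      ∀ c : complexBetti B.X (2 * n), IsRationalClass c → IsOfHodgeType (2 * n) B.X (2 * n) n n c →
        c ∈ weilEigenSpan B φ p n →
        ∀ k : ℕ, 2 ≤ k →
          (complexBetti.map (addMap B).hom.hom.hom (2 * n)).hom c ∈
            ⨆ a ∈ Finset.range (2 * n + 1), (kunnethPiece B k n a ⊓ algebraicClasses (B.prod B).X n)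

/-- The unconditional (sector-free) linear-algebra half, stated separately: `m^* c` lies in the sum of
the Künneth pieces `a = 0, …, 2n` (joint eigen-decomposition under `T_k^*`; no algebraicity). -/
def AddPullbackKunneth : Prop :=
  ∀ (n : ℕ) (B : AbelianVariety ℂ), B.dim = 2 * n → ∀ c : complexBetti B.X (2 * n), ∀ k : ℕ, 2 ≤ k →
    (complexBetti.map (addMap B).hom.hom.hom (2 * n)).hom c ∈ ⨆ a ∈ Finset.range (2 * n + 1), kunnethPiece B k n a

/-- The sector-dependent half in its sharpest form: EACH Künneth piece of `m^* c` is algebraic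
(equivalently, by Vandermonde, each `m_k^* c` is — which is bare pull-back functoriality). -/
def KunnethPiecesAlgebraic : Prop :=
  WeilSector → ∀ p : ℕ, p.Prime → p % 4 = 3 → 7 ≤ p → ∀ n : ℕ, 1 ≤ n →
    ∀ (B : AbelianVariety ℂ) (φ : B ⟶ B), B.dim = 2 * n → φ ≫ φ = -((p : ℤ) • 𝟙 B) →
      ∀ c : complexBetti B.X (2 * n), IsRationalClass c → IsOfHodgeType (2 * n) B.X (2 * n) n n c →
        c ∈ weilEigenSpan B φ p n →
        ∀ k : ℕ, 2 ≤ k → ∀ a : ℕ, ∀ d : complexBetti (B.prod B).X (2 * n),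
          d ∈ kunnethPiece B k n a →
          ((complexBetti.map (addMap B).hom.hom.hom (2 * n)).hom c - d ∈
              ⨆ b ∈ (Finset.range (2 * n + 1)).erase a, kunnethPiece B k n b) →
          d ∈ algebraicClasses (B.prod B).X n

/-- Glue (pure lattice logic): the two halves give the first lemma. -/
theorem inducedAnchorsTwo_of (h₁ : AddPullbackKunneth) (h₂ : KunnethPiecesAlgebraic)
    (hsplit : ∀ (n : ℕ) (B : AbelianVariety ℂ) (k : ℕ) (x : complexBetti (B.prod B).X (2 * n)),
      x ∈ (⨆ a ∈ Finset.range (2 * n + 1), kunnethPiece B k n a) →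
      ∃ d : ℕ → complexBetti (B.prod B).X (2 * n),
        (∀ a, d a ∈ kunnethPiece B k n a) ∧
        (∀ a, x - d a ∈ ⨆ b ∈ (Finset.range (2 * n + 1)).erase a, kunnethPiece B k n b) ∧
        x = ∑ a ∈ Finset.range (2 * n + 1), d a) :
    InducedAnchorsTwo := by
  intro hW p hp h4 h7 n hn B φ hdim hφ c hrat hhodge hweil k hk
  obtain ⟨d, hd, hdiff, hsum⟩ := hsplit n B k _ (h₁ n B hdim c k hk)
  rw [hsum]
  refine Submodule.sum_mem _ fun a ha => ?_
  have halg : d a ∈ algebraicClasses (B.prod B).X n :=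
    h₂ hW p hp h4 h7 n hn B φ hdim hφ c hrat hhodge hweil k hk a (d a) (hd a) (hdiff a)
  exact Submodule.mem_iSup_of_mem a (Submodule.mem_iSup_of_mem ha ⟨hd a, halg⟩)

/-! ## §3 The conjecture-grade engine the line then needs (informal; untypable until unitary PEL
families / `E`-actions land): DE-NORMING TRANSPORT `T_ind(E/K)` — in every component of every
split `E`-Weil family `S_E` (`E ⊇ K` Galois CM), algebraicity of the `E`-Weil classes propagates
from the Hecke orbit of the `K`-induced sub-Shimura locus `{B ⊗_K E}` to every CM point
`⊕ A_{Φ_i}` (`Σ Φ_i` constant).  With it: sector ⇒ all split `E`-Weil classes (`E ∋ √-p`) ⇒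
(Deligne LNM900 §5 made algebraic = André 1992) HC for ALL CM abelian varieties ⇒ (Milne 1999)
Tate for abelian varieties over finite fields.  Recorded here only as the target of §2's anchors. -/

end Summit.HodgeConjecture.HodgeConjecture.Cruxes.SummitOffWeilSector.WeilInductionAnchors

end
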